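import Summits.QuantumFields.QCD.Theses.QuarksAsStableAction
import Summits.QuantumFields.QCD.Theorems.QuarksAsStableActionStableActionBridgeOfSplit
import Summits.QuantumFields.QCD.Theorems.QuarksAsStableActionUnquenchedChessboardBound
import Summits.QuantumFields.QCD.Theorems.QuarksAsStableActionWilsonQuarkStability

/-!
# The crux `QuarksAsStableAction.StableActionBridge` (stmt-QuantumFields-9737) is equivalent to the conjunct `QCD`
# and to the conjunction of the two items it was split into

Line `Sketch`, continuation lead c7, cycle 8 (helper file, `--supports stmt-QuantumFields-9737`; registered sub-goals
`stableActionBridge_iff_qcd`, `stableActionBridge_iff_thresholdQCD_and_chiralCompletion`).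

Both hypotheses of the bridge `StableActionBridge := UnquenchedChessboardBound → WilsonQuarkStability → QCD` are now
theorems of the tree — A = item stmt-QuantumFields-9735 (`UnquenchedChessboardBoundLine.UnquenchedChessboardBound_of`) and
S = item stmt-QuantumFields-9736 (`Cruxes.WilsonQuarkStability.FreeTangentLandauChessboard.WilsonQuarkStability_of`) — so the
crux is exactly the sub-problem conjunct `QCD := QCDOf 2 ∧ QCDOf 3`; and by the lossless-split lemma
`Theorems.qcd_iff_thresholdQCD_and_chiralCompletion` (p131993) it is exactly the conjunction of the two items of the planner's
split (route-repair 0d71b161): `ThresholdQCD` (stmt-QuantumFields-8794) and `ChiralCompletion` (stmt-QuantumFields-17394).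
Pure logic over landed theorems; no analysis.
-/

namespace Summit.QuantumFields.QCD.Cruxes.StableActionBridge.Sketch

open Summit.QuantumFields.QCD.Theses.QuarksAsStableAction (UnquenchedChessboardBound WilsonQuarkStability
  StableActionBridge ChiralCompletion ThresholdQCD)

/-- **The bridge is the conjunct.**  With A (item 9735) and S (item 9736) proved in the tree,
`StableActionBridge ↔ QCD`. [folklore] -/
theorem stableActionBridge_iff_qcd : StableActionBridge ↔ _root_.QCD :=
  ⟨fun h => h Summit.QuantumFields.QCD.Theorems.UnquenchedChessboardBoundLine.UnquenchedChessboardBound_of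
      Summit.QuantumFields.QCD.Cruxes.WilsonQuarkStability.FreeTangentLandauChessboard.WilsonQuarkStability_of,
    fun h _ _ => h⟩

/-- **The split is exact for the crux.**  `StableActionBridge ↔ (ThresholdQCD ∧ ChiralCompletion)`: the crux closes by
`Theorems.stableActionBridgeOfSplit_proof` the moment items 8794 and 17394 close, and conversely implies both. [folklore] -/
theorem stableActionBridge_iff_thresholdQCD_and_chiralCompletion :
    StableActionBridge ↔ (ThresholdQCD ∧ ChiralCompletion) :=
  stableActionBridge_iff_qcd.trans Summit.QuantumFields.QCD.Theorems.qcd_iff_thresholdQCD_and_chiralCompletion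

end Summit.QuantumFields.QCD.Cruxes.StableActionBridge.Sketch
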